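import Literature.Barriers.ABC.NoArithmeticDerivativeSmallDerivCube
import HarnessLib

/-!
# abc ⟹ Small Derivatives (Pasten 2021, Cor. 4.6): discharge of `smallDerivatives_of_abcQualityForm`

`Literature/Barriers/ABC/NoArithmeticDerivativeSmallDerivProofs.lean` proves
`Literature.Barriers.ABC.Pasten.smallDerivatives_of_abcQualityForm_holds`:
the Masser–Oesterlé abc conjecture (`ABCQualityForm`, equivalently its `C(ε)` form by
`abcQualityForm_iff_forall_exists_const`) implies Pasten's Small Derivatives Conjecture
(`SmallDerivativesConjecture`, Conj. 3.9) — the first half of [cite: Pasten2021, Cor. 4.6], there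
obtained from Thm. 4.5 (Oesterlé's abc with exponent `1 < M < 2` gives every
`η > 1 − (2−M)/(4M)`). We obtain the explicit exponent `η = 7/8`.

## Proof (elementary replacement of the geometry-of-numbers step)

For a non-excluded abc triple with `c` large, put `H + 1 = ⌈c^{7/8}⌉` and look for `ψ`
supported on the primes of `abc` with `linF ψ = 0` ((EqnAdd), i.e. `ψ ∈ 𝒯(a,b)`), `ψ` not
degenerate (i.e. `W^ψ(a,b) ≠ 0`) and `‖ψ‖ ≤ H < c^{7/8}`:

* **Case A** (`exists_of_sepPair`, Core file): two primes in different members with coefficients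
  `(n/p)·v_p(n) ≤ H` give an explicit two-term `ψ`.
* **Case B** (`exists_of_cube`, Cube file): otherwise all primes `> H` of `abc` coincide
  (`large_primes_eq`), the member containing `2` has a partner prime `q₂ ≤ √c` in another
  member (`exists_pivot`: else the other two members are `1`/prime, i.e. the triple is excluded
  `(1, N, q)` or Case A), and the cube pigeonhole applies once the master inequality
  `(2·coefSum+1)·2^{ω}·c·2q₂·badProd < (H+1)²·rad(abc)` holds. Its inputs: `coefSum ≤ c·Ω(abc)`,
  `2^{Ω} ≤ abc ≤ c³`, `(2^ω)^{64} ≤ (2^{2^{64}})^{64}·c³` (`two_pow_card_pow_le`),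
  `badProd^{64} ≤ (64^{64})^{64}·c³` (`badProd_pow_le`), `(2q₂)² ≤ 4c`, and abc with `ε = 1/16`
  (`rad(abc) > (c/C)^{16/17}`); `numerics` then compares `c^{21/8 + o(1)}` with
  `c^{7/4 + 16/17}` for `c ≥ c₀`.

Finiteness: the exceptional triples have `c < c₀`, hence lie in a finite box. The only inputs
from the source's proof that survive are Pasten's divisibility on `𝒯°(a,b)` (proof of Lemma 4.4)
and the role of abc as a lower bound for `rad(abc)`; Siegel's lemma / Minkowski II (Thm. 2.5,
[cite: Pasten2021, Thm. 2.6]) are not needed for the implication abc ⟹ SDC.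
-/

open Finset

namespace Literature.Barriers.ABC.Pasten

open Literature.NumberTheory.DiophantineGeometry

/-! ### Elementary counting bounds -/

/-- `(2^{#s})^k ≤ (2^{2^k})^k · ∏_{p ∈ s} p` for a finite set `s` of positive integers: at most
`2^k` elements are `< 2^k`, and each other element absorbs a factor `2^k`. (A crude
`2^{ω(n)} ≪_ε n^ε`.) [folklore] -/
theorem two_pow_card_pow_le (k : ℕ) (s : Finset ℕ) (hs : ∀ p ∈ s, 1 ≤ p) :
    (2 ^ #s) ^ k ≤ (2 ^ 2 ^ k) ^ k * ∏ p ∈ s, p := by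
  set s₁ := s.filter (· < 2 ^ k) with hs₁
  set s₂ := s.filter (fun p => ¬ p < 2 ^ k) with hs₂
  have hcard : #s = #s₁ + #s₂ := (Finset.card_filter_add_card_filter_not _).symm
  have h1 : #s₁ ≤ 2 ^ k := by
    calc #s₁ ≤ #(Finset.range (2 ^ k)) :=
          Finset.card_le_card fun p hp => Finset.mem_range.mpr (Finset.mem_filter.mp hp).2
      _ = 2 ^ k := Finset.card_range _
  have h2 : (2 ^ #s₂) ^ k ≤ ∏ p ∈ s, p := by
    calc (2 ^ #s₂) ^ k = ∏ p ∈ s₂, 2 ^ k := by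
          rw [Finset.prod_const, ← pow_mul, ← pow_mul, mul_comm]
      _ ≤ ∏ p ∈ s₂, p := Finset.prod_le_prod' fun p hp => not_lt.mp (Finset.mem_filter.mp hp).2
      _ ≤ ∏ p ∈ s, p := Finset.prod_le_prod_of_subset_of_one_le' (Finset.filter_subset _ _)
          fun p hp _ => hs p hp
  calc (2 ^ #s) ^ k = (2 ^ #s₁) ^ k * (2 ^ #s₂) ^ k := by rw [hcard, pow_add, mul_pow]
    _ ≤ (2 ^ 2 ^ k) ^ k * ∏ p ∈ s, p :=
        Nat.mul_le_mul (Nat.pow_le_pow_left (Nat.pow_le_pow_right (by norm_num) h1) _) h2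

variable {a b c : ℕ}

/-- `2^{Ω(n)} ≤ n`, `Ω(n) = Σ_{p ∣ n} v_p(n)`. [folklore] -/
theorem two_pow_sum_factorization_le {n : ℕ} (hn : n ≠ 0) :
    2 ^ (∑ p ∈ n.primeFactors, n.factorization p) ≤ n := by
  calc 2 ^ (∑ p ∈ n.primeFactors, n.factorization p)
      = ∏ p ∈ n.primeFactors, 2 ^ n.factorization p := (Finset.prod_pow_eq_pow_sum _ _ _).symm
    _ ≤ ∏ p ∈ n.primeFactors, p ^ n.factorization p :=
        Finset.prod_le_prod' fun p hp => Nat.pow_le_pow_left (Nat.prime_of_mem_primeFactors hp).two_le _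
    _ = n := by
        -- `∏_{p ∣ n} p^{v_p(n)} = n` (Mathlib's `Nat.prod_factorization_pow_eq_self`, unfolded)
        have hself := Nat.prod_factorization_pow_eq_self hn
        rwa [Finsupp.prod, Nat.support_factorization] at hself

/-- `badProd^k ≤ (k^k)^k · abc`: a bad prime `p` has `p ≤ v_p(abc)`, so the bad primes `≥ k`
satisfy `p^k ≤ p^{v_p(abc)}`, and there are at most `k` bad primes `< k`. (Pasten uses instead
`∏ v_p(abc) ≤ d(abc) ≪_ε c^ε`, Lemma 4.3.) [folklore] -/
theorem badProd_pow_le (h : IsABCTriple a b c) (k : ℕ) :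
    badProd a b c ^ k ≤ (k ^ k) ^ k * (a * b * c) := by
  have hn : a * b * c ≠ 0 := by
    obtain ⟨ha, hb, habc, -⟩ := h
    exact mul_ne_zero (mul_ne_zero ha.ne' hb.ne') (by omega)
  set J := (a * b * c).primeFactors with hJ
  set Bd := J.filter (fun p => p ∣ (a * b * c).factorization p) with hBd
  set B₁ := Bd.filter (· < k) with hB₁
  set B₂ := Bd.filter (fun p => ¬ p < k) with hB₂
  have hsplit : badProd a b c = (∏ p ∈ B₁, p) * ∏ p ∈ B₂, p := by
    unfold badProd
    exact (Finset.prod_filter_mul_prod_filter_not Bd (· < k) (fun p => p)).symm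
  have h1 : (∏ p ∈ B₁, p) ^ k ≤ (k ^ k) ^ k := by
    refine Nat.pow_le_pow_left ?_ _
    calc ∏ p ∈ B₁, p ≤ k ^ #B₁ :=
          Finset.prod_le_pow_card _ _ _ fun p hp => (Finset.mem_filter.mp hp).2.le
      _ ≤ k ^ k := by
          rcases Nat.eq_zero_or_pos k with rfl | hk
          · simp [hB₁]
          · refine Nat.pow_le_pow_right hk ?_
            calc #B₁ ≤ #(Finset.range k) :=
                  Finset.card_le_card fun p hp => Finset.mem_range.mpr (Finset.mem_filter.mp hp).2
              _ = k := Finset.card_range _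
  have h2 : (∏ p ∈ B₂, p) ^ k ≤ a * b * c := by
    rw [← Finset.prod_pow]
    calc ∏ p ∈ B₂, p ^ k ≤ ∏ p ∈ B₂, p ^ (a * b * c).factorization p := by
          refine Finset.prod_le_prod' fun p hp => ?_
          obtain ⟨hpBd, hpk⟩ := Finset.mem_filter.mp hp
          obtain ⟨hpJ, hpdvd⟩ := Finset.mem_filter.mp hpBd
          have hpos : 0 < (a * b * c).factorization p :=
            (Nat.prime_of_mem_primeFactors hpJ).factorization_pos_of_dvd hn
              (Nat.dvd_of_mem_primeFactors hpJ)
          exact Nat.pow_le_pow_right (Nat.prime_of_mem_primeFactors hpJ).pos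
            ((not_lt.mp hpk).trans (Nat.le_of_dvd hpos hpdvd))
      _ ≤ ∏ p ∈ J, p ^ (a * b * c).factorization p :=
          Finset.prod_le_prod_of_subset_of_one_le'
            ((Finset.filter_subset _ _).trans (Finset.filter_subset _ _))
            fun p hp _ => Nat.one_le_pow _ _ (Nat.prime_of_mem_primeFactors hp).pos
      _ = a * b * c := by
          have hself := Nat.prod_factorization_pow_eq_self hn
          rwa [Finsupp.prod, Nat.support_factorization] at hself
  calc badProd a b c ^ k = (∏ p ∈ B₁, p) ^ k * (∏ p ∈ B₂, p) ^ k := by rw [hsplit, mul_pow]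
    _ ≤ (k ^ k) ^ k * (a * b * c) := Nat.mul_le_mul h1 h2

/-- `coefSum ≤ c · Ω(abc)`. [folklore] -/
theorem coefSum_le (h : IsABCTriple a b c) :
    coefSum a b c ≤ c * ∑ p ∈ (a * b * c).primeFactors, (a * b * c).factorization p := by
  unfold coefSum
  rw [Finset.mul_sum]
  exact Finset.sum_le_sum fun p hp => coef_le h hp

/-- `abc ≤ c³`. [folklore] -/
theorem abc_le_cube (h : IsABCTriple a b c) : a * b * c ≤ c ^ 3 := by
  obtain ⟨-, -, habc, -⟩ := h
  have ha : a ≤ c := by omega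
  have hb : b ≤ c := by omega
  calc a * b * c ≤ c * c * c := by gcongr
    _ = c ^ 3 := by ring

/-- `2 ∣ abc` for an abc triple (`a, b` odd forces `c = a + b` even). [folklore] -/
theorem two_mem_primeFactors (h : IsABCTriple a b c) : 2 ∈ (a * b * c).primeFactors := by
  obtain ⟨ha, hb, habc, -⟩ := h
  have hn : a * b * c ≠ 0 := mul_ne_zero (mul_ne_zero ha.ne' hb.ne') (by omega)
  refine Nat.mem_primeFactors.mpr ⟨Nat.prime_two, ?_, hn⟩
  rcases Nat.even_or_odd a with hae | hao
  · exact (even_iff_two_dvd.mp hae).mul_right _ |>.mul_right _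
  rcases Nat.even_or_odd b with hbe | hbo
  · exact Dvd.dvd.mul_right ((even_iff_two_dvd.mp hbe).mul_left _) _
  · have hce : Even c := habc ▸ Odd.add_odd hao hbo
    exact (even_iff_two_dvd.mp hce).mul_left _

/-- `rad a b c` (radical in `ℕ`) is `radOf (abc) = ∏_{p ∣ abc} p`. [folklore] -/
theorem rad_eq_radOf (a b c : ℕ) : rad a b c = radOf (a * b * c) := by
  rw [rad_def, Nat.radical_eq_prod_primeFactors]
  rfl

/-- A positive `m ≤ c` without prime factors `q` with `q² ≤ c` is `1` or a prime. [folklore] -/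
theorem eq_one_or_prime_of_no_small_factor {m c : ℕ} (hm : 0 < m) (hmc : m ≤ c)
    (H0 : ∀ q : ℕ, q.Prime → q * q ≤ c → ¬ q ∣ m) : m = 1 ∨ m.Prime := by
  by_cases h1 : m = 1
  · exact Or.inl h1
  refine Or.inr (by_contra fun hnp => ?_)
  have hsq := Nat.minFac_sq_le_self hm hnp
  refine H0 m.minFac (Nat.minFac_prime h1) ?_ (Nat.minFac_dvd m)
  calc m.minFac * m.minFac = m.minFac ^ 2 := (sq _).symm
    _ ≤ m := hsq
    _ ≤ c := hmc

/-- The coefficient of a prime MEMBER of the triple is `1` (`coef P = (P/P) · v_P(P)`).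
[folklore] -/
theorem coef_eq_one_of_prime (h : IsABCTriple a b c) {P : ℕ} (hP : P.Prime)
    (hmem : P = a ∨ P = b ∨ P = c) : coef a b c P = 1 := by
  have hself : P ∈ P.primeFactors := (Nat.mem_primeFactors_of_ne_zero hP.ne_zero).mpr ⟨hP, dvd_rfl⟩
  have key : memberOf a b c P = P := by
    rcases hmem with rfl | rfl | rfl
    · exact memberOf_of_mem_a hself
    · exact memberOf_of_mem_b h hself
    · exact memberOf_of_mem_c h hself
  unfold coef
  rw [key, Nat.div_self hP.pos, hP.factorization_self]

/-- **Pivot existence (Case B).** If the triple is not excluded and Case A fails (no two primes in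
different members with both coefficients `≤ H`, `1 ≤ H`), then some prime `q₂` with `q₂² ≤ c`
lies in a member different from the one containing `2`. (Otherwise the two members not
containing `2` are each `1` or a prime: `(1, q)` is excluded, `(q, q')` is Case A with
coefficients `1`.) [folklore] -/
theorem exists_pivot (h : IsABCTriple a b c) (hne : ¬ IsExcludedTriple a b c) {H : ℕ} (hH : 1 ≤ H)
    (hA : ¬ ∃ p ∈ (a * b * c).primeFactors, ∃ p' ∈ (a * b * c).primeFactors,
      SepPair a b c p p' ∧ coef a b c p ≤ H ∧ coef a b c p' ≤ H) :
    ∃ q₂ ∈ (a * b * c).primeFactors, SepPair a b c 2 q₂ ∧ q₂ * q₂ ≤ c := by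
  have h2 := two_mem_primeFactors h
  obtain ⟨ha, hb, habc, hab⟩ := h
  have hc : 0 < c := by omega
  have hac : a ≤ c := by omega
  have hbc : b ≤ c := by omega
  have h' : IsABCTriple a b c := ⟨ha, hb, habc, hab⟩
  have hn : a * b * c ≠ 0 := mul_ne_zero (mul_ne_zero ha.ne' hb.ne') hc.ne'
  have dab := hab.disjoint_primeFactors
  have dac := (coprime_ac h').disjoint_primeFactors
  have dbc := (coprime_bc h').disjoint_primeFactors
  have hJ := primeFactors_abc h'
  -- membership helpers
  have memJ : ∀ {q m : ℕ}, q.Prime → q ∣ m → (m = a ∨ m = b ∨ m = c) →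
      q ∈ (a * b * c).primeFactors := by
    intro q m hq hqm hm
    refine Nat.mem_primeFactors.mpr ⟨hq, ?_, hn⟩
    rcases hm with rfl | rfl | rfl
    · exact (hqm.mul_right _).mul_right _
    · exact (Dvd.dvd.mul_left hqm _).mul_right _
    · exact hqm.mul_left _
  -- Case A from two prime members
  have caseA_of_primes : ∀ {P Q : ℕ}, P.Prime → Q.Prime →
      ((P = a ∧ Q = b) ∨ (P = a ∧ Q = c) ∨ (P = b ∧ Q = c)) → False := by
    intro P Q hP hQ hPQ
    apply hA
    have hPJ : P ∈ (a * b * c).primeFactors :=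
      memJ hP dvd_rfl (by rcases hPQ with ⟨h1, -⟩ | ⟨h1, -⟩ | ⟨h1, -⟩ <;> simp [h1])
    have hQJ : Q ∈ (a * b * c).primeFactors :=
      memJ hQ dvd_rfl (by rcases hPQ with ⟨-, h1⟩ | ⟨-, h1⟩ | ⟨-, h1⟩ <;> simp [h1])
    have hPs : P ∈ P.primeFactors := (Nat.mem_primeFactors_of_ne_zero hP.ne_zero).mpr ⟨hP, dvd_rfl⟩
    have hQs : Q ∈ Q.primeFactors := (Nat.mem_primeFactors_of_ne_zero hQ.ne_zero).mpr ⟨hQ, dvd_rfl⟩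
    refine ⟨P, hPJ, Q, hQJ, ?_, ?_, ?_⟩
    · rcases hPQ with ⟨rfl, rfl⟩ | ⟨rfl, rfl⟩ | ⟨rfl, rfl⟩
      · exact ⟨fun hh => Finset.disjoint_left.mp dab hh.2 hQs,
          fun hh => Finset.disjoint_left.mp dab hPs hh.1,
          fun hh => Finset.disjoint_left.mp dac hPs hh.1⟩
      · exact ⟨fun hh => Finset.disjoint_left.mp dac hh.2 hQs,
          fun hh => Finset.disjoint_left.mp dab hPs hh.1,
          fun hh => Finset.disjoint_left.mp dac hPs hh.1⟩
      · exact ⟨fun hh => Finset.disjoint_left.mp dab hh.1 hPs,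
          fun hh => Finset.disjoint_left.mp dbc hh.2 hQs,
          fun hh => Finset.disjoint_left.mp dbc hPs hh.1⟩
    · rw [coef_eq_one_of_prime h' hP (by rcases hPQ with ⟨h1, -⟩ | ⟨h1, -⟩ | ⟨h1, -⟩ <;> simp [h1])]
      exact hH
    · rw [coef_eq_one_of_prime h' hQ (by rcases hPQ with ⟨-, h1⟩ | ⟨-, h1⟩ | ⟨-, h1⟩ <;> simp [h1])]
      exact hH
  -- the two members not containing `2` cannot both lie in `{1} ∪ primes`
  have key : ∀ {m₁ m₂ : ℕ}, 0 < m₁ → 0 < m₂ → m₁ ≤ c → m₂ ≤ c →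
      ((m₁ = 1 ∨ m₁.Prime) → (m₂ = 1 ∨ m₂.Prime) → False) →
      ∃ q : ℕ, q.Prime ∧ q * q ≤ c ∧ (q ∣ m₁ ∨ q ∣ m₂) := by
    intro m₁ m₂ h1 h2 h1c h2c hnot
    by_contra hno
    push Not at hno
    apply hnot
    · exact eq_one_or_prime_of_no_small_factor h1 h1c fun q hq hqq hqm => (hno q hq hqq).1 hqm
    · exact eq_one_or_prime_of_no_small_factor h2 h2c fun q hq hqq hqm => (hno q hq hqq).2 hqm
  have hc1 : c ≠ 1 := by omega
  have pfa : ∀ {q}, q.Prime → q ∣ a → q ∈ a.primeFactors := fun hq hd =>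
    Nat.mem_primeFactors.mpr ⟨hq, hd, ha.ne'⟩
  have pfb : ∀ {q}, q.Prime → q ∣ b → q ∈ b.primeFactors := fun hq hd =>
    Nat.mem_primeFactors.mpr ⟨hq, hd, hb.ne'⟩
  have pfc : ∀ {q}, q.Prime → q ∣ c → q ∈ c.primeFactors := fun hq hd =>
    Nat.mem_primeFactors.mpr ⟨hq, hd, hc.ne'⟩
  rw [hJ, Finset.mem_union, Finset.mem_union] at h2
  rcases h2 with (h2 | h2) | h2
  · -- `2 ∣ a`: look at `b` and `c`
    obtain ⟨q, hq, hqq, hqd⟩ := key hb hc hbc le_rfl fun hb1 hc1' => by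
      rcases hc1' with hc1' | hcP
      · exact hc1 hc1'
      rcases hb1 with hb1 | hbP
      · exact hne (Or.inr ⟨hb1, Or.inr hcP⟩)
      · exact caseA_of_primes hbP hcP (Or.inr (Or.inr ⟨rfl, rfl⟩))
    have hqbc : q ∈ b.primeFactors ∨ q ∈ c.primeFactors := hqd.imp (pfb hq) (pfc hq)
    have hqJ : q ∈ (a * b * c).primeFactors := by
      rw [hJ, Finset.mem_union, Finset.mem_union]
      exact hqbc.elim (fun h => Or.inl (Or.inr h)) Or.inr
    refine ⟨q, hqJ, ⟨?_, ?_, ?_⟩, hqq⟩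
    · rintro ⟨-, hqa⟩
      exact hqbc.elim (Finset.disjoint_left.mp dab hqa) (Finset.disjoint_left.mp dac hqa)
    · rintro ⟨h2b, -⟩; exact Finset.disjoint_left.mp dab h2 h2b
    · rintro ⟨h2c, -⟩; exact Finset.disjoint_left.mp dac h2 h2c
  · -- `2 ∣ b`: look at `a` and `c`
    obtain ⟨q, hq, hqq, hqd⟩ := key ha hc hac le_rfl fun ha1 hc1' => by
      rcases hc1' with hc1' | hcP
      · exact hc1 hc1'
      rcases ha1 with ha1 | haP
      · exact hne (Or.inl ⟨ha1, Or.inr hcP⟩)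
      · exact caseA_of_primes haP hcP (Or.inr (Or.inl ⟨rfl, rfl⟩))
    have hqac : q ∈ a.primeFactors ∨ q ∈ c.primeFactors := hqd.imp (pfa hq) (pfc hq)
    have hqJ : q ∈ (a * b * c).primeFactors := by
      rw [hJ, Finset.mem_union, Finset.mem_union]
      exact hqac.elim (fun h => Or.inl (Or.inl h)) Or.inr
    refine ⟨q, hqJ, ⟨?_, ?_, ?_⟩, hqq⟩
    · rintro ⟨h2a, -⟩; exact Finset.disjoint_left.mp dab h2a h2
    · rintro ⟨-, hqb⟩
      exact hqac.elim (fun hqa => Finset.disjoint_left.mp dab hqa hqb)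
        (fun hqc => Finset.disjoint_left.mp dbc hqb hqc)
    · rintro ⟨h2c, -⟩; exact Finset.disjoint_left.mp dbc h2 h2c
  · -- `2 ∣ c`: look at `a` and `b`
    obtain ⟨q, hq, hqq, hqd⟩ := key ha hb hac hbc fun ha1 hb1 => by
      rcases ha1 with ha1 | haP <;> rcases hb1 with hb1 | hbP
      · refine hne (Or.inl ⟨ha1, Or.inr ?_⟩)
        have : c = 2 := by omega
        rw [this]; exact Nat.prime_two
      · exact hne (Or.inl ⟨ha1, Or.inl hbP⟩)
      · exact hne (Or.inr ⟨hb1, Or.inl haP⟩)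
      · exact caseA_of_primes haP hbP (Or.inl ⟨rfl, rfl⟩)
    have hqab : q ∈ a.primeFactors ∨ q ∈ b.primeFactors := hqd.imp (pfa hq) (pfb hq)
    have hqJ : q ∈ (a * b * c).primeFactors := by
      rw [hJ, Finset.mem_union, Finset.mem_union]
      exact Or.inl hqab
    refine ⟨q, hqJ, ⟨?_, ?_, ?_⟩, hqq⟩
    · rintro ⟨h2a, -⟩; exact Finset.disjoint_left.mp dac h2a h2
    · rintro ⟨h2b, -⟩; exact Finset.disjoint_left.mp dbc h2b h2
    · rintro ⟨-, hqc⟩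
      exact hqab.elim (fun hqa => Finset.disjoint_left.mp dac hqa hqc)
        (fun hqb => Finset.disjoint_left.mp dbc hqb hqc)
/-- **Numerics for the master inequality** (pure real analysis). With `η = 7/8`, the height
`Hs = ⌈c^{7/8}⌉` and any constants `C, A₁, A₂`, for `c ≥ c₀(C, A₁, A₂)`: `3 ≤ Hs ≤ c ≤ (Hs−1)²`,
and whenever `2^Ω ≤ c³`, `(2^N)^{64} ≤ A₁^{64} c³`, `bad^{64} ≤ A₂^{64} c³`, `q² ≤ 4c`,
`cs ≤ c·Ω` and `c < C · r^{17/16}` (abc with `ε = 1/16`), then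
`(2cs+1) · 2^N · c · q · bad < Hs² · r`. Proof: with `u = c^{1/1088}` everything is a monomial
in `u`; the left side is `≤ A₀ u^{2823}`, the right side `> u^{2928}/C^{16/17}`. [folklore] -/
theorem numerics (C A₁ A₂ : ℝ) (hC : 0 < C) (hA₁ : 1 ≤ A₁) (hA₂ : 1 ≤ A₂) :
    ∃ c₀ : ℕ, ∀ c : ℕ, c₀ ≤ c →
      (3 ≤ ⌈(c : ℝ) ^ ((7 : ℝ) / 8)⌉₊ ∧ ⌈(c : ℝ) ^ ((7 : ℝ) / 8)⌉₊ ≤ c ∧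
        c ≤ (⌈(c : ℝ) ^ ((7 : ℝ) / 8)⌉₊ - 1) * (⌈(c : ℝ) ^ ((7 : ℝ) / 8)⌉₊ - 1)) ∧
      ∀ (Ω N bad r q cs : ℕ), (2 : ℝ) ^ Ω ≤ (c : ℝ) ^ 3 →
        ((2 : ℝ) ^ N) ^ 64 ≤ A₁ ^ 64 * (c : ℝ) ^ 3 → (bad : ℝ) ^ 64 ≤ A₂ ^ 64 * (c : ℝ) ^ 3 →
        (q : ℝ) ^ 2 ≤ 4 * c → (cs : ℝ) ≤ c * Ω → 0 < r →
        (c : ℝ) < C * (r : ℝ) ^ ((17 : ℝ) / 16) →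
        ((2 * cs + 1) * 2 ^ N * c * q * bad : ℝ) < (⌈(c : ℝ) ^ ((7 : ℝ) / 8)⌉₊ : ℝ) ^ 2 * r := by
  -- constants
  set C' : ℝ := C ^ ((16 : ℝ) / 17) with hC'
  clear_value C'
  have hC'pos : 0 < C' := by rw [hC']; exact Real.rpow_pos_of_pos hC _
  set A₀ : ℝ := 9793 * 2 * A₁ * A₂ with hA₀def
  clear_value A₀
  have hA₀ : 1 ≤ A₀ := by rw [hA₀def]; nlinarith
  set u₀ : ℝ := A₀ * C' + 2 with hu₀
  clear_value u₀
  have hu₀2 : 2 ≤ u₀ := by rw [hu₀]; nlinarith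
  refine ⟨⌈u₀ ^ 1088⌉₊, fun c hc => ?_⟩
  -- the base `u = c^{1/1088}`
  set x : ℝ := (c : ℝ) with hx
  clear_value x
  have hxu₀ : u₀ ^ 1088 ≤ x := (Nat.le_ceil _).trans (by rw [hx]; exact_mod_cast hc)
  have hu₀pow : (1 : ℝ) ≤ u₀ ^ 1088 := one_le_pow₀ (show (1 : ℝ) ≤ u₀ by linarith)
  have hx1 : 1 ≤ x := hu₀pow.trans hxu₀
  have hx0 : 0 < x := by linarith
  set u : ℝ := x ^ ((1 : ℝ) / 1088) with hu
  clear_value u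
  have upow : ∀ k : ℕ, u ^ k = x ^ ((k : ℝ) / 1088) := fun k => by
    rw [hu, ← Real.rpow_natCast, ← Real.rpow_mul hx0.le]
    congr 1
    ring
  have hu1088 : u ^ 1088 = x := by
    rw [upow]; norm_num
  have hu952 : u ^ 952 = x ^ ((7 : ℝ) / 8) := by
    rw [upow]; norm_num
  have hu1024 : u ^ 1024 = x ^ ((16 : ℝ) / 17) := by
    rw [upow]; norm_num
  have hupos : 0 < u := by rw [hu]; exact Real.rpow_pos_of_pos hx0 _
  have huu₀ : u₀ ≤ u := by
    by_contra hlt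
    push Not at hlt
    have := pow_lt_pow_left₀ hlt hupos.le (by norm_num : (1088 : ℕ) ≠ 0)
    rw [hu1088] at this
    linarith
  have hu2 : 2 ≤ u := hu₀2.trans huu₀
  have hu1 : 1 ≤ u := by linarith
  have hmono : ∀ {m n : ℕ}, m ≤ n → u ^ m ≤ u ^ n := fun hmn => pow_le_pow_right₀ hu1 hmn
  -- the height `Hs = ⌈x^{7/8}⌉`
  set Hs : ℕ := ⌈x ^ ((7 : ℝ) / 8)⌉₊ with hHs
  clear_value Hs
  have hHs_ge : u ^ 952 ≤ (Hs : ℝ) := by rw [hu952, hHs]; exact Nat.le_ceil _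
  have h952 : (3 : ℝ) ≤ u ^ 952 := by
    calc (3 : ℝ) ≤ 2 ^ 2 := by norm_num
      _ ≤ 2 ^ 952 := pow_le_pow_right₀ (by norm_num) (by norm_num)
      _ ≤ u ^ 952 := pow_le_pow_left₀ (by norm_num) hu2 _
  refine ⟨⟨?_, ?_, ?_⟩, ?_⟩
  · -- 3 ≤ Hs
    exact_mod_cast h952.trans hHs_ge
  · -- Hs ≤ c
    rw [hHs]
    refine Nat.ceil_le.mpr ?_
    rw [← hu952, ← hx, ← hu1088]
    exact hmono (by norm_num)
  · -- c ≤ (Hs - 1)^2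
    have hHs1 : 1 ≤ Hs := by exact_mod_cast (show (1 : ℝ) ≤ Hs by linarith)
    have hreal : x ≤ ((Hs - 1 : ℕ) : ℝ) * ((Hs - 1 : ℕ) : ℝ) := by
      rw [Nat.cast_sub hHs1, Nat.cast_one]
      have h1 : u ^ 544 ≤ (Hs : ℝ) - 1 := by
        have : u ^ 544 + 1 ≤ u ^ 952 := by
          calc u ^ 544 + 1 ≤ u ^ 544 + u ^ 544 := by linarith [one_le_pow₀ (n := 544) hu1]
            _ = 2 * u ^ 544 := by ring
            _ ≤ u * u ^ 544 := by gcongr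
            _ = u ^ 545 := by ring
            _ ≤ u ^ 952 := hmono (by norm_num)
        linarith
      calc x = u ^ 544 * u ^ 544 := by rw [← hu1088]; ring
        _ ≤ ((Hs : ℝ) - 1) * ((Hs : ℝ) - 1) := by
          apply mul_le_mul h1 h1 (by positivity) (by linarith [one_le_pow₀ (n := 544) hu1])
    rw [hx] at hreal
    exact_mod_cast hreal
  -- the master inequality
  intro Ω N bad r q cs hΩ hN hbad hq hcs hr habc
  have hr0 : (0 : ℝ) < r := by exact_mod_cast hr
  -- (b1) Ω ≤ 4896 u
  have bΩ : (Ω : ℝ) ≤ 4896 * u := by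
    have h1 : (Ω : ℝ) * Real.log 2 ≤ 3 * (1088 * Real.log u) := by
      have := Real.log_le_log (by positivity) hΩ
      rw [Real.log_pow, Real.log_pow, ← hu1088, Real.log_pow] at this
      push_cast at this
      linarith
    have h2 : Real.log u ≤ u - 1 := Real.log_le_sub_one_of_pos hupos
    have h3 : (0.6931471803 : ℝ) < Real.log 2 := Real.log_two_gt_d9
    have h4 : (0 : ℝ) ≤ Ω := Nat.cast_nonneg _
    nlinarith
  -- (b2) 2^N ≤ A₁ u^51, (b3) bad ≤ A₂ u^51
  have hx3 : x ^ 3 = (u ^ 51) ^ 64 := by rw [← hu1088]; ring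
  have b2 : (2 : ℝ) ^ N ≤ A₁ * u ^ 51 := by
    refine le_of_pow_le_pow_left₀ (by norm_num : (64 : ℕ) ≠ 0) (by positivity) ?_
    calc ((2 : ℝ) ^ N) ^ 64 ≤ A₁ ^ 64 * x ^ 3 := hN
      _ = (A₁ * u ^ 51) ^ 64 := by rw [hx3]; ring
  have b3 : (bad : ℝ) ≤ A₂ * u ^ 51 := by
    refine le_of_pow_le_pow_left₀ (by norm_num : (64 : ℕ) ≠ 0) (by positivity) ?_
    calc (bad : ℝ) ^ 64 ≤ A₂ ^ 64 * x ^ 3 := hbad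
      _ = (A₂ * u ^ 51) ^ 64 := by rw [hx3]; ring
  -- (b4) q ≤ 2 u^544
  have b4 : (q : ℝ) ≤ 2 * u ^ 544 := by
    refine le_of_pow_le_pow_left₀ (by norm_num : (2 : ℕ) ≠ 0) (by positivity) ?_
    calc (q : ℝ) ^ 2 ≤ 4 * x := hq
      _ = (2 * u ^ 544) ^ 2 := by rw [← hu1088]; ring
  -- (b5) 2 cs + 1 ≤ 9793 u^1089
  have b5 : (2 * cs + 1 : ℝ) ≤ 9793 * u ^ 1089 := by
    have h1 : (cs : ℝ) ≤ u ^ 1088 * (4896 * u) := by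
      rw [hu1088]; exact hcs.trans (mul_le_mul_of_nonneg_left bΩ hx0.le)
    have h2 : (1 : ℝ) ≤ u ^ 1089 := one_le_pow₀ hu1
    calc (2 * cs + 1 : ℝ) ≤ 2 * (u ^ 1088 * (4896 * u)) + u ^ 1089 := by linarith
      _ = 9793 * u ^ 1089 := by ring
  -- (b6) u^1024 < C' r
  have b6 : u ^ 1024 < C' * r := by
    rw [hu1024, hC']
    have := Real.rpow_lt_rpow hx0.le habc (show (0 : ℝ) < 16 / 17 by norm_num)
    rw [Real.mul_rpow hC.le (by positivity), ← Real.rpow_mul hr0.le] at this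
    norm_num at this
    exact this
  -- LHS ≤ A₀ u^2823
  have hL : ((2 * cs + 1) * 2 ^ N * x * q * bad : ℝ) ≤ A₀ * u ^ 2823 := by
    rw [← hu1088]
    calc ((2 * cs + 1) * 2 ^ N * u ^ 1088 * q * bad : ℝ)
        ≤ (9793 * u ^ 1089) * (A₁ * u ^ 51) * u ^ 1088 * (2 * u ^ 544) * (A₂ * u ^ 51) := by
          gcongr
      _ = A₀ * u ^ 2823 := by rw [hA₀def]; ring
  -- A₀ C' u^2823 ≤ u^2928
  have hmid : A₀ * C' * u ^ 2823 ≤ u ^ 2928 := by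
    have h1 : A₀ * C' ≤ u := by linarith
    have h2 : u ≤ u ^ 105 := by
      calc u = u ^ 1 := (pow_one u).symm
        _ ≤ u ^ 105 := hmono (by norm_num)
    calc A₀ * C' * u ^ 2823 ≤ u ^ 105 * u ^ 2823 := by gcongr; exact h1.trans h2
      _ = u ^ 2928 := by ring
  -- u^2928 < C' Hs² r
  have hR : u ^ 2928 < C' * ((Hs : ℝ) ^ 2 * r) := by
    have h1 : u ^ 1904 ≤ (Hs : ℝ) ^ 2 := by
      calc u ^ 1904 = (u ^ 952) ^ 2 := by ring
        _ ≤ (Hs : ℝ) ^ 2 := pow_le_pow_left₀ (by positivity) hHs_ge 2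
    calc u ^ 2928 = u ^ 1904 * u ^ 1024 := by ring
      _ < u ^ 1904 * (C' * r) := by gcongr
      _ ≤ (Hs : ℝ) ^ 2 * (C' * r) := by gcongr
      _ = C' * ((Hs : ℝ) ^ 2 * r) := by ring
  -- conclude
  have : C' * ((2 * cs + 1) * 2 ^ N * x * q * bad : ℝ) < C' * ((Hs : ℝ) ^ 2 * r) := by
    calc C' * ((2 * cs + 1) * 2 ^ N * x * q * bad : ℝ) ≤ C' * (A₀ * u ^ 2823) := by gcongr
      _ = A₀ * C' * u ^ 2823 := by ring
      _ ≤ u ^ 2928 := hmid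
      _ < C' * ((Hs : ℝ) ^ 2 * r) := hR
  exact lt_of_mul_lt_mul_left this hC'pos.le


/-- **At most one large good prime when Case A fails**: if `c ≤ H²` and no two primes in different
members have both coefficients `≤ H`, then all primes `p ∣ abc` with `p > H` coincide (two of
them in one member `n` would give `p p' ∣ n ≤ c ≤ H²`; in different members they would be a
Case-A pair, since `p > H ≥ √c` forces `v_p = 1` and `coef p = n/p ≤ H`). [folklore] -/
theorem large_primes_eq (h : IsABCTriple a b c) {H : ℕ} (hcH : c ≤ H * H)
    (hA : ¬ ∃ p ∈ (a * b * c).primeFactors, ∃ p' ∈ (a * b * c).primeFactors,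
      SepPair a b c p p' ∧ coef a b c p ≤ H ∧ coef a b c p' ≤ H) :
    ∀ p ∈ (a * b * c).primeFactors, ∀ p' ∈ (a * b * c).primeFactors,
      ¬ p ∣ (a * b * c).factorization p → ¬ p' ∣ (a * b * c).factorization p' →
      H < p → H < p' → p = p' := by
  intro p hp p' hp' _ _ hHp hHp'
  by_contra hne
  have hpP := Nat.prime_of_mem_primeFactors hp
  have hp'P := Nat.prime_of_mem_primeFactors hp'
  -- a prime `> H` has coefficient `≤ H`
  have coef_small : ∀ q ∈ (a * b * c).primeFactors, H < q → coef a b c q ≤ H := by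
    intro q hq hHq
    obtain ⟨hqm, hmc, -⟩ := mem_primeFactors_memberOf h hq
    have hqP := Nat.prime_of_mem_primeFactors hqm
    have hm0 : memberOf a b c q ≠ 0 := (Nat.mem_primeFactors.mp hqm).2.2
    have hfac : (memberOf a b c q).factorization q = 1 := by
      have hge : 1 ≤ (memberOf a b c q).factorization q :=
        hqP.factorization_pos_of_dvd hm0 (Nat.dvd_of_mem_primeFactors hqm)
      have hlt : ¬ 2 ≤ (memberOf a b c q).factorization q := fun h2 => by
        have hdvd : q ^ 2 ∣ memberOf a b c q := (hqP.pow_dvd_iff_le_factorization hm0).mpr h2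
        have hle : q ^ 2 ≤ memberOf a b c q := Nat.le_of_dvd (Nat.pos_of_ne_zero hm0) hdvd
        nlinarith
      omega
    unfold coef
    rw [hfac, mul_one]
    refine Nat.div_le_of_le_mul ?_
    calc memberOf a b c q ≤ c := hmc
      _ ≤ H * H := hcH
      _ ≤ q * H := Nat.mul_le_mul_right _ hHq.le
  by_cases hsep : SepPair a b c p p'
  · exact hA ⟨p, hp, p', hp', hsep, coef_small p hp hHp, coef_small p' hp' hHp'⟩
  -- otherwise both lie in one member `n ≤ c ≤ H²`, impossible for two primes `> H`
  have same : ∀ n : ℕ, n ≤ c → p ∈ n.primeFactors → p' ∈ n.primeFactors → False := by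
    intro n hnc hpn hp'n
    have hn0 : 0 < n := Nat.pos_of_ne_zero (Nat.mem_primeFactors.mp hpn).2.2
    have hdvd : p * p' ∣ n :=
      Nat.Coprime.mul_dvd_of_dvd_of_dvd ((Nat.coprime_primes hpP hp'P).mpr hne)
        (Nat.dvd_of_mem_primeFactors hpn) (Nat.dvd_of_mem_primeFactors hp'n)
    have hle : p * p' ≤ n := Nat.le_of_dvd hn0 hdvd
    nlinarith
  have hac : a ≤ c := by obtain ⟨-, -, habc, -⟩ := h; omega
  have hbc : b ≤ c := by obtain ⟨-, -, habc, -⟩ := h; omega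
  unfold SepPair at hsep
  push Not at hsep
  by_cases h1 : p ∈ a.primeFactors ∧ p' ∈ a.primeFactors
  · exact same a hac h1.1 h1.2
  by_cases h2 : p ∈ b.primeFactors ∧ p' ∈ b.primeFactors
  · exact same b hbc h2.1 h2.2
  · have h3 := hsep (fun hpa hp'a => h1 ⟨hpa, hp'a⟩) (fun hpb hp'b => h2 ⟨hpb, hp'b⟩)
    exact same c le_rfl h3.1 h3.2

/-- **Main step**: under `ABCQualityForm`, every non-excluded abc triple with `c ≥ c₀` admits
`ψ ∈ 𝒯(a,b)` with `a, b` `ψ`-independent and `‖ψ‖ < c^{7/8}` (Pasten, Thm. 4.5 gives every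
`η > 1 − (2−M)/(4M)` from Oesterlé's abc with exponent `M`; here the explicit `η = 7/8` from the
full Masser–Oesterlé conjecture, by the elementary Case A / Case B dichotomy of this file).
[cite: Pasten2021, Thm. 4.5 and Cor. 4.6] -/
theorem exists_small_of_large (hABC : ABCQualityForm) :
    ∃ c₀ : ℕ, ∀ a b c : ℕ, IsABCTriple a b c → ¬ IsExcludedTriple a b c → c₀ ≤ c →
      ∃ ψ : ℕ → ℤ, IsAdapted ψ a b ∧ wronskian ψ a b ≠ 0 ∧
        ∀ p : ℕ, (|ψ p| : ℝ) < (c : ℝ) ^ ((7 : ℝ) / 8) := by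
  obtain ⟨C, hC, hCabc⟩ := forall_exists_const_of_abcQualityForm hABC (1 / 16) (by norm_num)
  obtain ⟨c₀, hc₀⟩ := numerics C (2 ^ 2 ^ 64) (64 ^ 64) hC (one_le_pow₀ (by norm_num))
    (one_le_pow₀ (by norm_num))
  refine ⟨c₀, fun a b c h hne hc => ?_⟩
  obtain ⟨⟨hS1, hS2, hS3⟩, hmain⟩ := hc₀ c hc
  set Hs : ℕ := ⌈(c : ℝ) ^ ((7 : ℝ) / 8)⌉₊ with hHs
  clear_value Hs
  -- the height `H = Hs - 1`
  obtain ⟨H, rfl⟩ : ∃ H : ℕ, Hs = H + 1 := ⟨Hs - 1, by omega⟩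
  have hH2 : 2 ≤ H := by omega
  have hHc : H + 1 ≤ c := hS2
  have hcH : c ≤ H * H := by simpa using hS3
  have hHreal : (H : ℝ) < (c : ℝ) ^ ((7 : ℝ) / 8) := by
    have := Nat.ceil_lt_add_one (Real.rpow_nonneg (Nat.cast_nonneg c) ((7 : ℝ) / 8))
    rw [← hHs] at this
    push_cast at this
    linarith
  -- reduction to the combinatorial statement
  suffices hψ : ∃ ψ : ℕ → ℤ, (∀ q, q ∉ (a * b * c).primeFactors → ψ q = 0) ∧ linF a b c ψ = 0 ∧
      ¬ Degenerate a b c ψ ∧ ∀ q, |ψ q| ≤ H by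
    obtain ⟨ψ, hsupp, hF, hnd, hbound⟩ := hψ
    refine ⟨ψ, ⟨fun p hp => ?_, additive_of_linF_eq_zero h hF⟩,
      wronskian_ne_zero_of_not_degenerate h hF hnd, fun p => ?_⟩
    · have hpJ : p ∈ (a * b * c).primeFactors := by
        by_contra hpJ; exact hp (hsupp p hpJ)
      rw [h.2.2.1]
      exact ⟨Nat.prime_of_mem_primeFactors hpJ, Nat.dvd_of_mem_primeFactors hpJ⟩
    · calc (|ψ p| : ℝ) ≤ H := by exact_mod_cast hbound p
        _ < (c : ℝ) ^ ((7 : ℝ) / 8) := hHreal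
  by_cases hA : ∃ p ∈ (a * b * c).primeFactors, ∃ p' ∈ (a * b * c).primeFactors,
      SepPair a b c p p' ∧ coef a b c p ≤ H ∧ coef a b c p' ≤ H
  · -- Case A
    obtain ⟨p, hp, p', hp', hsep, hcp, hcp'⟩ := hA
    obtain ⟨ψ, hsupp, hF, hnd, hbound⟩ := exists_of_sepPair h hp hp' hsep
    exact ⟨ψ, hsupp, hF, hnd, fun q => (hbound q).trans (by exact_mod_cast max_le hcp hcp')⟩
  · -- Case B
    obtain ⟨q₂, hq₂, hsep, hq₂c⟩ := exists_pivot h hne (by omega) hA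
    have hq₂H : q₂ ≤ H := by
      by_contra hlt
      have : (H + 1) * (H + 1) ≤ q₂ * q₂ := Nat.mul_le_mul (by omega) (by omega)
      nlinarith
    have hn : a * b * c ≠ 0 := by
      obtain ⟨ha, hb, habc, -⟩ := h
      exact mul_ne_zero (mul_ne_zero ha.ne' hb.ne') (by omega)
    refine exists_of_cube h H (two_mem_primeFactors h) hq₂ hsep hH2 hq₂H hHc
      (large_primes_eq h hcH hA) ?_
    -- the master inequality, from `numerics`
    have hrad_pos : 0 < radOf (a * b * c) :=
      Finset.prod_pos fun p hp => (Nat.prime_of_mem_primeFactors hp).pos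
    have h1 : (2 : ℝ) ^ (∑ p ∈ (a * b * c).primeFactors, (a * b * c).factorization p) ≤ (c : ℝ) ^ 3 := by
      exact_mod_cast (two_pow_sum_factorization_le hn).trans (abc_le_cube h)
    have h2 : ((2 : ℝ) ^ #(a * b * c).primeFactors) ^ 64 ≤ (2 ^ 2 ^ 64) ^ 64 * (c : ℝ) ^ 3 := by
      have := two_pow_card_pow_le 64 (a * b * c).primeFactors
        fun p hp => (Nat.prime_of_mem_primeFactors hp).pos
      have hr : ∏ p ∈ (a * b * c).primeFactors, p ≤ c ^ 3 :=
        (Nat.le_of_dvd (Nat.pos_of_ne_zero hn) (Nat.prod_primeFactors_dvd _)).trans (abc_le_cube h)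
      exact_mod_cast this.trans (Nat.mul_le_mul_left _ hr)
    have h3 : (badProd a b c : ℝ) ^ 64 ≤ (64 ^ 64) ^ 64 * (c : ℝ) ^ 3 := by
      exact_mod_cast (badProd_pow_le h 64).trans (Nat.mul_le_mul_left _ (abc_le_cube h))
    have h4 : ((2 * q₂ : ℕ) : ℝ) ^ 2 ≤ 4 * c := by
      have : (2 * q₂) ^ 2 ≤ 4 * c := by nlinarith
      exact_mod_cast this
    have h5 : (coefSum a b c : ℝ) ≤ c * (∑ p ∈ (a * b * c).primeFactors, (a * b * c).factorization p : ℕ) := by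
      exact_mod_cast coefSum_le h
    have h6 : (c : ℝ) < C * (radOf (a * b * c) : ℝ) ^ ((17 : ℝ) / 16) := by
      have := hCabc a b c h
      rw [rad_eq_radOf] at this
      convert this using 2
      norm_num
    have := hmain _ _ _ _ _ _ h1 h2 h3 h4 h5 hrad_pos h6
    exact_mod_cast this

/-- **Discharge of `smallDerivatives_of_abcQualityForm`** (Pasten 2021, Corollary 4.6, first
half: the Masser–Oesterlé abc conjecture implies the Small Derivatives Conjecture, via
Theorem 4.5). We take `η = 7/8`: for all but finitely many non-excluded abc triples there is
`ψ ∈ 𝒯(a,b)` with `a, b` `ψ`-independent and `‖ψ‖ < c^{7/8}`. The printed proof uses the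
Bombieri–Vaaler Siegel lemma (Minkowski's second theorem), not in Mathlib; this formalisation
replaces it by an elementary cube pigeonhole against the degenerate lattice `𝒯°(a,b)` (files
`NoArithmeticDerivativeSmallDerivCore`, `…Cube`), keeping Pasten's two arithmetic inputs — the
divisibility `p ∣ v_p(abc) ψ(ξ_p)` on `𝒯°(a,b)` (proof of Lemma 4.4) and abc in the form
`rad(abc) ≫ c^{16/17}`. [cite: Pasten2021, Cor. 4.6 and Thm. 4.5] -/
theorem smallDerivatives_of_abcQualityForm_holds : smallDerivatives_of_abcQualityForm := by
  intro hABC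
  obtain ⟨c₀, hc₀⟩ := exists_small_of_large hABC
  refine ⟨7 / 8, by norm_num, by norm_num, ?_⟩
  refine ((Set.finite_Iic c₀).prod ((Set.finite_Iic c₀).prod (Set.finite_Iic c₀))).subset ?_
  rintro ⟨a, b, c⟩ ⟨ht, hne, hno⟩
  dsimp only at ht hne hno
  have hc : c < c₀ := by
    by_contra hge
    exact hno (hc₀ a b c ht hne (not_lt.mp hge))
  obtain ⟨ha, hb, habc, -⟩ := ht
  simp only [Set.mem_prod, Set.mem_Iic]
  omega

end Literature.Barriers.ABC.Pasten
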